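import Mathlib
import Summits.Ventures.PercRepro2.Defs
import Summits.Ventures.PercRepro2.SepFamJoint
import Summits.Ventures.PercRepro2.SepFamMixed

/-!
# The colour-preference form of BHK06 for two independent copies — the independent endpoint of the
switching family (blind cell PercRepro2, p3 g15, 2026-08-27; `proofs/P3-CPNC.md` §2)

`m9` of row 2′CSW is, per fibre, the statement that for a uniform 2-colouring `(Y, W)` of the edges of
a finite multigraph, conditioned on `{p,q} ↮ {r,s}` in BOTH colours, the colour preferences
`f(Y-side) − f(W-side)` and `g(Y-side) − g(W-side)` of the two sides are negatively correlated
(`proofs/P3-CPNC.md` §1, the statement (CPNC); `f = 1[p ~ q]`, `g = 1[r ~ s]` is `m9`).  That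
complementary model is the extreme point of the family of SYMMETRIC bi-edge product models
(`P3-CPNC` §2); its INDEPENDENT member — `Y` and `W` two independent copies of the same product
law — is exactly van den Berg–Häggström–Kahn 2006 (doi:10.1002/rsa.20102, Theorem 2.1 at `q = 1`,
Remark 1 for root sets), which the tree holds as `SepPA.sep_fam_mixed_closed` (p3 g13).  This file
records that endpoint in the colour-preference form: for two independent copies `ω, ω'` of a product
law with weights in `[0, 1]`, disjoint root sets `X, Y`, and monotone functionals `f` of the `X`-tuple
of clusters and `g` of the `Y`-tuple,

  `E_ω E_ω' [ 1_S(ω) 1_S(ω') · (f(expl X ω) − f(expl X ω')) · (g(expl Y ω) − g(expl Y ω')) ] ≤ 0`,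

`S = sepFam X Y = {X ↮ Y}`.  Proof: the double expectation expands by linearity to
`2 · (P(S) · E[1_S f g] − E[1_S f] · E[1_S g])`, and `sep_fam_mixed_closed` with `H₁ = f(X-tuple)`,
`H₂ = −g(Y-tuple)` (mixed-order monotone) gives `P(S) · E[1_S f g] ≤ E[1_S f] · E[1_S g]`.
The complementary endpoint (`m9` / (CPNC)) is NOT claimed here — it is the open statement; this file
only fixes, in the kernel, which theorem of the tree the family's independent endpoint is.
Own work on the cell's `SepPA` chain; standard axioms.
-/

namespace Summit.Ventures.PercRepro2

namespace SepPA

open Finset Classical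

section CPNCIndependent

variable {V : Type*} {E : Type*} [Fintype V] [Fintype E] [DecidableEq E]
variable (ends : E → Sym2 V) (p : E → ℝ) {X Y : Finset V}

/-- Linearity of `expect` for a combination of four functions with real coefficients. -/
lemma expect_lin4 (α β γ δ : ℝ) (F₁ F₂ F₃ F₄ : Config E → ℝ) :
    expect p (fun ω => α * F₁ ω + β * F₂ ω + γ * F₃ ω + δ * F₄ ω) =
      α * expect p F₁ + β * expect p F₂ + γ * expect p F₃ + δ * expect p F₄ := by
  unfold expect
  have h : ∀ ω, weight p ω * (α * F₁ ω + β * F₂ ω + γ * F₃ ω + δ * F₄ ω) =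
      α * (weight p ω * F₁ ω) + β * (weight p ω * F₂ ω) + γ * (weight p ω * F₃ ω) +
        δ * (weight p ω * F₄ ω) := fun ω => by ring
  simp only [h, Finset.sum_add_distrib, ← Finset.mul_sum]

omit [Fintype V] in
/-- The expectation of the separation indicator is the probability of the separation event. -/
lemma expect_sepFam_indicator (X Y : Finset V) :
    expect p (fun ω => (sepFam ends X Y).indicator (fun _ => (1 : ℝ)) ω) =
      prob p (sepFam ends X Y) := by
  rw [prob_eq_expect_indicator]
  rfl

/-- **The independent endpoint of the colour-preference family is BHK06.**  For two independent
copies `ω, ω'` of the product law `p` (weights in `[0, 1]`), disjoint root sets `X, Y`, and monotone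
`f : (X → Set V) → ℝ`, `g : (Y → Set V) → ℝ`:
`E_ω E_ω' [1_S(ω) 1_S(ω') (f(expl X ω) − f(expl X ω')) (g(expl Y ω) − g(expl Y ω'))] ≤ 0`
with `S = sepFam X Y` — the symmetric sign form of (CPNC) (`proofs/P3-CPNC.md` §1) in the
independent model, equal to `2 (P(S) E[1_S f g] − E[1_S f] E[1_S g])`, which is
`sep_fam_mixed_closed` (van den Berg–Häggström–Kahn 2006, Theorem 2.1 at `q = 1`). -/
theorem cpnc_independent (hp : ∀ e, 0 ≤ p e ∧ p e ≤ 1) (hXY : Disjoint X Y)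
    (f : (X → Set V) → ℝ) (g : (Y → Set V) → ℝ) (hf : Monotone f) (hg : Monotone g) :
    expect p (fun ω => expect p (fun ω' =>
      (sepFam ends X Y).indicator (fun _ => (1 : ℝ)) ω *
        (sepFam ends X Y).indicator (fun _ => (1 : ℝ)) ω' *
        ((f (expl ends ω X) - f (expl ends ω' X)) *
          (g (expl ends ω Y) - g (expl ends ω' Y))))) ≤ 0 := by
  set S : Config E → ℝ := (sepFam ends X Y).indicator (fun _ => (1 : ℝ)) with hS
  set P : ℝ := prob p (sepFam ends X Y) with hPdef
  set a : ℝ := expect p (fun ω => S ω * (f (expl ends ω X) * g (expl ends ω Y))) with ha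
  set b : ℝ := expect p (fun ω => S ω * f (expl ends ω X)) with hb
  set c : ℝ := expect p (fun ω => S ω * g (expl ends ω Y)) with hc
  have hP : expect p (fun ω => S ω) = P := expect_sepFam_indicator ends p X Y
  -- BHK06 (the tree's `sep_fam_mixed_closed`) with `H₁ = f(X-tuple)`, `H₂ = −g(Y-tuple)`
  have key : expect p (fun ω => S ω * f (expl ends ω X)) *
      expect p (fun ω => S ω * -g (expl ends ω Y)) ≤
      P * expect p (fun ω => S ω * (f (expl ends ω X) * -g (expl ends ω Y))) :=
    sep_fam_mixed_closed ends p hp hXY (fun _ k => f k) (fun t _ => -g t)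
      (fun _ => antitone_const) (fun _ => hf) (fun _ => hg.neg) (fun _ => monotone_const)
  have e1 : expect p (fun ω => S ω * -g (expl ends ω Y)) = -c := by
    have h : (fun ω => S ω * -g (expl ends ω Y)) =
        fun ω => (-1 : ℝ) * (S ω * g (expl ends ω Y)) := by
      funext ω; ring
    rw [h, expect_const_mul]; ring
  have e2 : expect p (fun ω => S ω * (f (expl ends ω X) * -g (expl ends ω Y))) = -a := by
    have h : (fun ω => S ω * (f (expl ends ω X) * -g (expl ends ω Y))) =
        fun ω => (-1 : ℝ) * (S ω * (f (expl ends ω X) * g (expl ends ω Y))) := by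
      funext ω; ring
    rw [h, expect_const_mul]; ring
  rw [e1, e2] at key
  have key' : P * a ≤ b * c := by linarith
  -- the inner expectation, for a fixed `ω`
  have inner : ∀ ω, expect p (fun ω' => S ω * S ω' *
      ((f (expl ends ω X) - f (expl ends ω' X)) * (g (expl ends ω Y) - g (expl ends ω' Y)))) =
      S ω * (f (expl ends ω X) * g (expl ends ω Y) * P - f (expl ends ω X) * c -
        g (expl ends ω Y) * b + a) := by
    intro ω
    have h : (fun ω' => S ω * S ω' *
        ((f (expl ends ω X) - f (expl ends ω' X)) * (g (expl ends ω Y) - g (expl ends ω' Y)))) =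
        fun ω' => (S ω * f (expl ends ω X) * g (expl ends ω Y)) * S ω' +
          (-(S ω * f (expl ends ω X))) * (S ω' * g (expl ends ω' Y)) +
          (-(S ω * g (expl ends ω Y))) * (S ω' * f (expl ends ω' X)) +
          (S ω) * (S ω' * (f (expl ends ω' X) * g (expl ends ω' Y))) := by
      funext ω'; ring
    rw [h, expect_lin4, hP, ← ha, ← hb, ← hc]
    ring
  -- the outer expectation
  have outer : expect p (fun ω => expect p (fun ω' => S ω * S ω' *
      ((f (expl ends ω X) - f (expl ends ω' X)) * (g (expl ends ω Y) - g (expl ends ω' Y))))) =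
      2 * (P * a - b * c) := by
    have h : (fun ω => expect p (fun ω' => S ω * S ω' *
        ((f (expl ends ω X) - f (expl ends ω' X)) * (g (expl ends ω Y) - g (expl ends ω' Y))))) =
        fun ω => P * (S ω * (f (expl ends ω X) * g (expl ends ω Y))) +
          (-c) * (S ω * f (expl ends ω X)) + (-b) * (S ω * g (expl ends ω Y)) + a * S ω := by
      funext ω
      rw [inner ω]
      ring
    rw [h, expect_lin4, hP, ← ha, ← hb, ← hc]
    ring
  rw [outer]
  linarith

end CPNCIndependent

end SepPA

end Summit.Ventures.PercRepro2
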